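import Summits.CriticalPhenomena.CardyFormulaZ2.Theorems.CardyMagicRigidityMarkovCascadeDefs
import Literature.Barriers.CriticalPhenomena.NestingTransformBlindness
import Literature.Probability.Percolation.FKLoopNestingIntegrable
import Summits.CriticalPhenomena.CardyFormulaZ2.Theorems.CardyMagicRigidityNestingRigidityFusionBaseCases
import HarnessLib

/-!
# The winding hole of a loop; round circles are two-sided (line `markov-cascade-one-generation`, crux `NestingRigidity`)

Crux `Summit.CriticalPhenomena.CardyFormulaZ2.Theses.CardyMagicRigidity.NestingRigidity`
(stmt-CriticalPhenomena-4835), line `markov-cascade-one-generation`; helper lemmas toward stub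
`stub_kernelUniqueness : KernelUniqueness` (`DomainTransfer → KernelTransfer`, S4) over the
definitions module `CardyMagicRigidityMarkovCascadeDefs` (`holeOf`, `TwoSided`, `AdmissibleIn`,
`DomainTransfer`, `KernelTransfer`).  Everything here is closed (no hypothesis of the crux):

* §1 the winding hole `holeOf u = {W(u, ·) ≠ 0}` of an unbased loop: disjoint from the trace
  (`unbasedLoop_wind_of_mem_range` of the sibling line `ring-cloud-tomography`), open,
  bounded, blind to orientation, and STABLE OFF THE TRACE — along `uδ → u` the symmetric difference
  `holeOf (uδ δ) ∆ holeOf u` lies in the collar `{dist(·, range u) ≤ d(u, uδ δ)}`, and a compact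
  subset of `holeOf u` (e.g. the support of an admissible test function, `AdmissibleIn`) lies in
  `holeOf (uδ δ)` eventually;
* the loop metric is dominated by pointwise distances of traces (`unbasedLoop_udist_le_diam_union`):
  the elementary fact behind the matching of micro-loops by micro-loops that `LoopConfig.IsClose ε`
  demands below scale `ε` (a loop of diameter `< ε/2` is `ε`-matched by any loop within `ε/2 − diam`);
* §2 the round circle `windLoop c r 1` (barrier file `NestingTransformBlindness`): its trace is the
  whole sphere, its hole is the open ball, and it is `TwoSided`.  Hence the families quantified in
  `DomainTransfer` / `KernelTransfer` exist (the statements are not vacuous), and `KernelTransfer`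
  specialises to the closed-b.c. ensembles of balls — the instance iterated by
  `stub_cascadeReconstruction` (`kernelTransfer_ball`, `domainTransfer_ball`).
-/

noncomputable section

open MeasureTheory Set Filter
open scoped Topology BigOperators ENNReal Real

namespace Summit.CriticalPhenomena.CardyFormulaZ2.Cruxes.NestingRigidity.MarkovCascadeOneGeneration

open Literature.Probability.RandomPlanarGeometry Literature.Probability.Percolation
  Literature.Probability.LatticeModels
open Literature.Barriers.CriticalPhenomena.NestingBlind
open Summit.CriticalPhenomena.CardyFormulaZ2.Cruxes.NestingRigidity.RingCloudTomography
  (unbasedLoop_wind_of_mem_range unbasedLoop_wind_eq_zero_of_subset_ball)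

/-! ## §1 The winding hole of a loop -/

/-- Membership in the hole, unfolded. -/
theorem mem_holeOf_iff {u : UnbasedLoop ℂ} {z : ℂ} : z ∈ holeOf u ↔ u.wind z ≠ 0 := Iff.rfl

/-- The hole misses the trace. -/
theorem disjoint_holeOf_range (u : UnbasedLoop ℂ) : Disjoint (holeOf u) u.range :=
  Set.disjoint_left.2 fun _ hz hr ↦ hz (unbasedLoop_wind_of_mem_range u hr)

/-- A point of the hole is off the trace, at positive distance from it. -/
theorem infDist_pos_of_mem_holeOf {u : UnbasedLoop ℂ} {z : ℂ} (hz : z ∈ holeOf u) :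
    0 < Metric.infDist z u.range :=
  (u.isCompact_range.isClosed.notMem_iff_infDist_pos u.range_nonempty).1
    fun h ↦ hz (unbasedLoop_wind_of_mem_range u h)

/-- **The hole is open**: the winding number is locally constant off the (closed) trace. -/
theorem isOpen_holeOf : ∀ u : UnbasedLoop ℂ, IsOpen (holeOf u) := by
  intro u
  rw [Metric.isOpen_iff]
  intro z hz
  refine ⟨Metric.infDist z u.range, infDist_pos_of_mem_holeOf hz, fun w hw ↦ ?_⟩
  rw [mem_holeOf_iff] at hz ⊢
  rwa [u.wind_eq_wind_of_dist_lt (Metric.mem_ball.1 hw)]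

/-- A loop inside a ball winds around no point outside it: the hole lies in every ball containing
the trace. -/
theorem holeOf_subset_ball {u : UnbasedLoop ℂ} {w : ℂ} {ρ : ℝ} (h : u.range ⊆ Metric.ball w ρ) :
    holeOf u ⊆ Metric.ball w ρ := by
  intro z hz
  by_contra hzw
  rw [Metric.mem_ball, not_lt] at hzw
  exact hz (unbasedLoop_wind_eq_zero_of_subset_ball u h hzw)

/-- **The hole is bounded** (the trace is compact). In particular the domains `holeOf (uδ δ)` of
the line are bounded, so their lattice discretisations are finite (§4). -/
theorem isBounded_holeOf : ∀ u : UnbasedLoop ℂ, Bornology.IsBounded (holeOf u) := by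
  intro u
  obtain ⟨ρ, hρ⟩ := u.isCompact_range.isBounded.subset_ball 0
  exact Metric.isBounded_ball.subset (holeOf_subset_ball hρ)

/-- The hole does not see the orientation of the loop. -/
@[simp] theorem holeOf_reverse (u : UnbasedLoop ℂ) : holeOf u.reverse = holeOf u := by
  ext z
  simp [mem_holeOf_iff, UnbasedLoop.wind_reverse]

/-- **Stability of the hole off the trace**: if `v` is closer to `u` (oriented unbased distance) than
`z` is to the trace of `u`, then `z` is in the hole of `v` iff it is in the hole of `u`
(`UnbasedLoop.wind_eq_of_dist_lt`). Along `uδ → u` this pins `holeOf (uδ δ) ∆ holeOf u` inside the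
collar `{dist(·, range u) ≤ d(uδ δ, u)}`. -/
theorem mem_holeOf_iff_of_dist_lt {u v : UnbasedLoop ℂ} {z : ℂ}
    (h : dist u v < Metric.infDist z u.range) : z ∈ holeOf v ↔ z ∈ holeOf u := by
  rw [mem_holeOf_iff, mem_holeOf_iff, UnbasedLoop.wind_eq_of_dist_lt h]

/-- **The two holes differ only in the collar**: the symmetric difference of the holes of `u` and
`v` lies within `dist u v` of the trace of `u`. -/
theorem symmDiff_holeOf_subset : ∀ {u v : UnbasedLoop ℂ},
    symmDiff (holeOf v) (holeOf u) ⊆ {z | Metric.infDist z u.range ≤ dist u v} := by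
  intro u v z hz
  by_contra h
  rw [mem_setOf_eq, not_le] at h
  have key := mem_holeOf_iff_of_dist_lt (z := z) h
  rcases hz with ⟨h₁, h₂⟩ | ⟨h₁, h₂⟩
  · exact h₂ (key.1 h₁)
  · exact h₂ (key.2 h₁)

/-- **A compact subset of the hole of `u` lies in the hole of every loop close enough to `u`**
(the distance to the trace attains a positive minimum on the compact set). -/
theorem exists_forall_subset_holeOf_of_dist_lt {u : UnbasedLoop ℂ} {K : Set ℂ} (hK : IsCompact K)
    (hKu : K ⊆ holeOf u) : ∃ ε > 0, ∀ v : UnbasedLoop ℂ, dist u v < ε → K ⊆ holeOf v := by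
  rcases K.eq_empty_or_nonempty with rfl | hne
  · exact ⟨1, one_pos, fun _ _ ↦ empty_subset _⟩
  obtain ⟨z₀, hz₀, hmin⟩ :=
    hK.exists_isMinOn hne (Metric.continuous_infDist_pt u.range).continuousOn
  refine ⟨Metric.infDist z₀ u.range, infDist_pos_of_mem_holeOf (hKu hz₀), fun v hv z hz ↦ ?_⟩
  exact (mem_holeOf_iff_of_dist_lt (hv.trans_le (isMinOn_iff.1 hmin z hz))).2 (hKu hz)

/-- Along a convergent family of loops `uδ → u`, a compact subset of the hole of the limit is
eventually inside the holes `holeOf (uδ δ)`. -/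
theorem eventually_subset_holeOf {u : UnbasedLoop ℂ} {K : Set ℂ} (hK : IsCompact K)
    (hKu : K ⊆ holeOf u) {ι : Type*} {l : Filter ι} {uδ : ι → UnbasedLoop ℂ}
    (h : Tendsto uδ l (𝓝 u)) : ∀ᶠ δ in l, K ⊆ holeOf (uδ δ) := by
  obtain ⟨ε, hε, hsub⟩ := exists_forall_subset_holeOf_of_dist_lt hK hKu
  filter_upwards [Metric.tendsto_nhds.1 h ε hε] with δ hδ
  exact hsub _ (by rwa [dist_comm] at hδ)

/-- The support of an admissible test function is compact (closed, inside the bounded hole). -/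
theorem AdmissibleIn.isCompact_tsupport {u : UnbasedLoop ℂ} {f : ℂ → ℝ} (hf : AdmissibleIn u f) :
    IsCompact (tsupport f) :=
  Metric.isCompact_of_isClosed_isBounded (isClosed_tsupport f)
    ((isBounded_holeOf u).subset hf.2.2.1)

/-- **Admissible test functions live in the holes of the family, eventually**: for `f` admissible
in `u` and `uδ → u`, `tsupport f ⊆ holeOf (uδ δ)` for all `δ` close to the limit point (so the
domain transforms of `DomainTransfer` see the whole support of `f`). -/
theorem AdmissibleIn.eventually_tsupport_subset_holeOf {u : UnbasedLoop ℂ} {f : ℂ → ℝ}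
    (hf : AdmissibleIn u f) {ι : Type*} {l : Filter ι} {uδ : ι → UnbasedLoop ℂ}
    (h : Tendsto uδ l (𝓝 u)) : ∀ᶠ δ in l, tsupport f ⊆ holeOf (uδ δ) :=
  eventually_subset_holeOf hf.isCompact_tsupport hf.2.2.1 h

/-- `AdmissibleIn.eventually_tsupport_subset_holeOf` with the admissibility as an explicit
hypothesis (registered name). -/
theorem eventually_tsupport_subset_holeOf_of_admissibleIn : ∀ {u : UnbasedLoop ℂ} {f : ℂ → ℝ},
    AdmissibleIn u f → ∀ {ι : Type*} {l : Filter ι} {uδ : ι → UnbasedLoop ℂ}, Tendsto uδ l (𝓝 u) →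
      ∀ᶠ δ in l, tsupport f ⊆ holeOf (uδ δ) :=
  fun hf _ _ _ h ↦ hf.eventually_tsupport_subset_holeOf h

/-! ### The loop metric is dominated by pointwise distances of the traces

The elementary fact behind the "soup matching" of `d_CN` below every scale: two loops whose traces
are uniformly within `C` of each other pointwise are `C`-close in DKKMO's distance, whatever their
parametrisations; so a loop of diameter `< ε/2` is `ε`-matched by ANY loop within `ε/2 − diam`. -/

section LoopMetric

variable {E : Type*} [MetricSpace E]

/-- **`dist u v ≤ C` as soon as every point of the trace of `u` is within `C` of every point of the
trace of `v`** (compare the two loops through any pair of parametrisations). -/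
theorem unbasedLoop_dist_le_of_forall {u v : UnbasedLoop E} {C : ℝ} (hC : 0 ≤ C)
    (h : ∀ x ∈ u.range, ∀ y ∈ v.range, dist x y ≤ C) : dist u v ≤ C := by
  obtain ⟨⟨c, hc⟩, rfl⟩ := UnbasedLoop.mk_surjective u
  obtain ⟨⟨c', hc'⟩, rfl⟩ := UnbasedLoop.mk_surjective v
  obtain ⟨α, rfl⟩ := CurveClass.surjective_mk c
  obtain ⟨β, rfl⟩ := CurveClass.surjective_mk c'
  rw [UnbasedLoop.dist_mk_mk]
  refine (BasedLoop.dist_le_dist_toCurveClass _ _).trans ?_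
  change dist (CurveClass.mk α) (CurveClass.mk β) ≤ C
  rw [CurveClass.dist_mk_mk]
  refine (Curve.dist_le_dist_toContinuousMap α β).trans ((ContinuousMap.dist_le hC).2 fun t ↦ ?_)
  exact h (α t) ⟨t, rfl⟩ (β t) ⟨t, rfl⟩

/-- The same bound for DKKMO's unoriented distance `d = udist`. -/
theorem unbasedLoop_udist_le_of_forall {u v : UnbasedLoop E} {C : ℝ} (hC : 0 ≤ C)
    (h : ∀ x ∈ u.range, ∀ y ∈ v.range, dist x y ≤ C) : u.udist v ≤ C :=
  (UnbasedLoop.udist_le_dist u v).trans (unbasedLoop_dist_le_of_forall hC h)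

/-- **Two loops are `d`-close within the diameter of the union of their traces.** -/
theorem unbasedLoop_udist_le_diam_union' (u v : UnbasedLoop E) :
    u.udist v ≤ Metric.diam (u.range ∪ v.range) :=
  unbasedLoop_udist_le_of_forall Metric.diam_nonneg fun _ hx _ hy ↦
    Metric.dist_le_diam_of_mem (u.isCompact_range.union v.isCompact_range).isBounded
      (Or.inl hx) (Or.inr hy)

/-- **Small loops near each other are close**: if the traces have diameters `≤ a`, `≤ b` and come
within `d` of each other, then `udist u v ≤ a + d + b`: the matching of micro-loops by nearby
micro-loops that `LoopConfig.IsClose ε` demands below scale `ε`. -/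
theorem unbasedLoop_udist_le_of_diam_le {u v : UnbasedLoop E} {a b d : ℝ}
    (ha : Metric.diam u.range ≤ a) (hb : Metric.diam v.range ≤ b)
    {x₀ y₀ : E} (hx₀ : x₀ ∈ u.range) (hy₀ : y₀ ∈ v.range) (hd : dist x₀ y₀ ≤ d) :
    u.udist v ≤ a + d + b := by
  have ha0 : 0 ≤ a := Metric.diam_nonneg.trans ha
  have hb0 : 0 ≤ b := Metric.diam_nonneg.trans hb
  have hd0 : 0 ≤ d := dist_nonneg.trans hd
  refine unbasedLoop_udist_le_of_forall (by positivity) fun x hx y hy ↦ ?_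
  calc dist x y ≤ dist x x₀ + dist x₀ y₀ + dist y₀ y := dist_triangle4 x x₀ y₀ y
    _ ≤ a + d + b := by
      gcongr
      · exact (Metric.dist_le_diam_of_mem u.isCompact_range.isBounded hx hx₀).trans ha
      · exact (Metric.dist_le_diam_of_mem v.isCompact_range.isBounded hy₀ hy).trans hb

end LoopMetric

/-- **Two loops are `d`-close within the diameter of the union of their traces** (registered
form of `unbasedLoop_udist_le_diam_union'`). -/
theorem unbasedLoop_udist_le_diam_union : ∀ {E : Type*} [MetricSpace E] (u v : UnbasedLoop E),
    u.udist v ≤ Metric.diam (u.range ∪ v.range) :=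
  fun u v ↦ unbasedLoop_udist_le_diam_union' u v

/-! ## §2 Round circles: trace, hole, two-sidedness; the statements are not vacuous -/

/-- **The trace of the circle `windLoop c r 1` is the whole sphere** (every point `c + r e^{iθ}` is
attained at the parameter `fract (θ / 2π)`). -/
theorem range_windLoop_one (c : ℂ) {r : ℝ} (hr : 0 ≤ r) :
    (windLoop c r 1).range = Metric.sphere c r := by
  refine Subset.antisymm ?_ ?_
  · simpa [abs_of_nonneg hr] using range_windLoop_subset_sphere c r 1
  · intro z hz
    rw [Metric.mem_sphere, Complex.dist_eq] at hz
    set x : ℝ := Complex.arg (z - c) / (2 * π) with hx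
    refine ⟨⟨Int.fract x, Int.fract_nonneg _, (Int.fract_lt_one _).le⟩, ?_⟩
    show windCurve c r 1 _ = z
    rw [windCurve_apply]
    have key : Complex.exp (2 * π * Complex.I * (1 : ℕ) * ((Int.fract x : ℝ) : ℂ)) =
        Complex.exp ((Complex.arg (z - c) : ℂ) * Complex.I) := by
      rw [Int.fract, Complex.ofReal_sub, Complex.ofReal_intCast,
        show (2 * π * Complex.I * (1 : ℕ) * ((x : ℂ) - (⌊x⌋ : ℂ)) : ℂ) =
          (Complex.arg (z - c) : ℂ) * Complex.I + (-⌊x⌋ : ℤ) * (2 * π * Complex.I) by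
          rw [hx]; push_cast; field_simp; ring,
        Complex.exp_add, Complex.exp_int_mul_two_pi_mul_I, mul_one]
    rw [key, ← hz, Complex.norm_mul_exp_arg_mul_I, add_sub_cancel]

/-- **The hole of the circle is the open ball**: `W = 1` inside (`wind_windLoop_of_dist_lt`), `0`
outside (`wind_windLoop_of_lt_dist`) and `0` on the sphere, which is the trace. This is the identity
`holeOf (round circle) = ball` through which `stub_cascadeReconstruction` reads `DomainLawTransfer`
off `KernelTransfer`. -/
theorem holeOf_windLoop_one : ∀ (c : ℂ) {r : ℝ}, 0 < r →
    holeOf (Literature.Barriers.CriticalPhenomena.NestingBlind.windLoop c r 1) = Metric.ball c r := by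
  intro c r hr
  ext z
  rw [mem_holeOf_iff, Metric.mem_ball]
  rcases lt_trichotomy (dist z c) r with h | h | h
  · rw [wind_windLoop_of_dist_lt c hr 1 h]
    simp [h]
  · have hz : z ∈ (windLoop c r 1).range := by
      rw [range_windLoop_one c hr.le]; exact Metric.mem_sphere.2 h
    rw [unbasedLoop_wind_of_mem_range _ hz]
    simp [h]
  · rw [wind_windLoop_of_lt_dist c r 1 (by rwa [abs_of_pos hr])]
    simp only [ne_eq, not_true_eq_false, false_iff, not_lt]
    exact h.le

/-- **Round circles are two-sided**: every point of the sphere is accumulated by the open ball (the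
hole) and by the open exterior (winding number `0`, off the trace). Hence `DomainTransfer` and
`KernelTransfer` quantify over a nonempty set of families (e.g. the constant family at a circle). -/
theorem twoSided_windLoop_one : ∀ (c : ℂ) {r : ℝ}, 0 < r →
    TwoSided (Literature.Barriers.CriticalPhenomena.NestingBlind.windLoop c r 1) := by
  intro c r hr
  have hrange := range_windLoop_one c hr.le
  refine ⟨?_, ?_⟩
  · rw [holeOf_windLoop_one c hr, closure_ball c hr.ne', hrange]
    exact Metric.sphere_subset_closedBall
  · rw [hrange]
    have hsub : (Metric.closedBall c r)ᶜ ⊆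
        {w | (windLoop c r 1).wind w = 0 ∧ w ∉ Metric.sphere c r} := by
      intro w hw
      rw [mem_compl_iff, Metric.mem_closedBall, not_le] at hw
      refine ⟨wind_windLoop_of_lt_dist c r 1 (by rwa [abs_of_pos hr]), fun h ↦ ?_⟩
      rw [Metric.mem_sphere] at h
      exact absurd h hw.ne'
    refine Subset.trans ?_ (closure_mono hsub)
    rw [closure_compl, interior_closedBall c hr.ne']
    intro z hz
    rw [Metric.mem_sphere] at hz
    rw [mem_compl_iff, Metric.mem_ball, hz]
    exact lt_irrefl r

/-- A two-sided loop with a convergent family exists: the constant family at the unit circle. -/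
theorem exists_twoSided_tendsto :
    ∃ (u : UnbasedLoop ℂ) (uδ : ℝ → UnbasedLoop ℂ), TwoSided u ∧ Tendsto uδ (𝓝[>] 0) (𝓝 u) :=
  ⟨windLoop 0 1 1, fun _ ↦ windLoop 0 1 1, twoSided_windLoop_one 0 one_pos, tendsto_const_nhds⟩

/-- **`KernelTransfer` in balls**: the merged first-generation kernels of the closed-b.c. ensembles
of `B(c, r)` — `KernelTransfer` applied to the constant family at the (two-sided) circle of radius
`r`, whose hole is the ball. This is the instance of `KernelTransfer` that `CascadeReconstruction`
iterates. -/
theorem kernelTransfer_ball : KernelTransfer → ∀ (c : ℂ) {r : ℝ}, 0 < r →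
    Tendsto (fun δ : ℝ ↦ LoopConfig.cnLawEDist P2 (fun ω ↦ firstGen (domLoopsZ2 (Metric.ball c r) δ ω))
      PT (fun ω ↦ firstGen (domLoopsT (Metric.ball c r) δ ω))) (𝓝[>] 0) (𝓝 0) := by
  intro h c r hr
  have := h (windLoop c r 1) (fun _ ↦ windLoop c r 1) (twoSided_windLoop_one c hr) tendsto_const_nhds
  simpa only [holeOf_windLoop_one c hr] using this

/-- **`DomainTransfer` in balls**: merged closed-b.c. domain transforms of `B(c, r)` for every test
function admissible in the ball (constant family at the circle). -/
theorem domainTransfer_ball (h : DomainTransfer) (c : ℂ) {r : ℝ} (hr : 0 < r) (f : ℂ → ℝ)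
    (hf : AdmissibleIn (windLoop c r 1) f) :
    Tendsto (fun δ : ℝ ↦ domTransformZ2 (Metric.ball c r) δ f - domTransformT (Metric.ball c r) δ f)
      (𝓝[>] 0) (𝓝 0) := by
  have := h (windLoop c r 1) (fun _ ↦ windLoop c r 1) (twoSided_windLoop_one c hr)
    tendsto_const_nhds f hf
  simpa only [holeOf_windLoop_one c hr] using this

/-- Admissibility in the circle of radius `r` is admissibility in the ball: measurable, bounded,
compactly supported inside `B(c, r)`, neutral. -/
theorem admissibleIn_windLoop_one_iff (c : ℂ) {r : ℝ} (hr : 0 < r) (f : ℂ → ℝ) :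
    AdmissibleIn (windLoop c r 1) f ↔
      Measurable f ∧ (∃ C : ℝ, ∀ z, |f z| ≤ C) ∧ tsupport f ⊆ Metric.ball c r ∧ ∫ z, f z = 0 := by
  rw [AdmissibleIn, holeOf_windLoop_one c hr]

end Summit.CriticalPhenomena.CardyFormulaZ2.Cruxes.NestingRigidity.MarkovCascadeOneGeneration

end
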